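import Mathlib.Combinatorics.Enumerative.Partition.Basic
import Mathlib.NumberTheory.ZetaValues
import Mathlib.Analysis.SpecialFunctions.Log.Deriv
import Mathlib.Analysis.SpecialFunctions.Pow.Real
import Mathlib.Analysis.SpecialFunctions.Sqrt
import Mathlib.Algebra.Order.Field.GeomSum
import HarnessLib

/-!
# An upper bound for the partition function: `p(n) ≤ e^{π√(2n/3)}` (Apostol, Thm. 14.5)

Topic `Literature/Combinatorics/Enumerative`. T. M. Apostol, *Introduction to Analytic Number
Theory* (UTM, Springer 1976), §14.7 "An upper bound for `p(n)`", Theorem 14.5 (p. 316; held copy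
`book:apostol1976-introduction-analytic-number-theory`, PDF pp. 216–217):

> **Theorem 14.5.** If `n ≥ 1` we have `p(n) < e^{K√n}`, where `K = π(2/3)^{1/2}`.

(Hardy–Ramanujan 1918: `p(n) ∼ e^{K√n}/(4n√3)`, so the constant `K` in the exponent is sharp.)
PROVED here for Mathlib's `Nat.Partition n` (`p(n) = Fintype.card (Nat.Partition n)`), in the
non-strict form valid for every `n` (`n = 0` gives equality `1 = e⁰`):

* `card_partition_mul_pow_le_prod` — the generating-function inequality
  `p(n) xⁿ ≤ ∏_{k=1}^{n} (1 - x^k)⁻¹` for `0 ≤ x < 1` (Apostol: "`p(n)xⁿ < F(x)`"), proved without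
  power series: a partition is determined by the multiplicities `c_k ≤ n` of its parts
  `k = 1, …, n`, and `xⁿ = ∏_k (x^k)^{c_k}`, so `p(n) xⁿ ≤ ∏_k ∑_{c ≤ n} (x^k)^c ≤ ∏_k (1 - x^k)⁻¹`;
* `sum_neg_log_one_sub_pow_le` — `∑_{k=1}^{n} -log(1 - x^k) ≤ (π²/6) · x/(1 - x)` for `0 < x < 1`
  (Apostol (10): `log F(x) = ∑_m (1/m) x^m/(1 - x^m) ≤ ∑_m (1/m²) · x/(1-x)`, using
  `m x^{m-1}(1 - x) < 1 - x^m` and `∑ 1/m² = π²/6`), hence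
  `prod_inv_one_sub_pow_le_exp` — `∏_{k=1}^{n} (1 - x^k)⁻¹ ≤ exp((π²/6) · x/(1 - x))`;
* `card_partition_le_exp_add` — `p(n) ≤ exp(n t + π²/(6t))` for every `t > 0`
  (`x = 1/(1+t)`, `log(1/x) = log(1 + t) ≤ t`), and with `t = π/√(6n)`:
* `card_partition_le_exp` — **`p(n) ≤ e^{π√(2n/3)}`**; also `card_partition_le_exp'`, the same
  bound written `e^{2(π/√6)√n}` (the form `p(n) ≤ e^{2c₁√n}`, `c₁ = π/√6`, used for the
  Vershik–Kerov lower bound on the largest degree of `𝔖ₙ`,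
  `Literature/RepresentationTheory/FiniteGroups/VershikKerovMaxDegreeProofs.lean`).

## References

* T. M. Apostol, *Introduction to Analytic Number Theory*, Springer 1976, §14.7, Theorem 14.5,
  pp. 316–318. [Apostol1976]
* G. H. Hardy, S. Ramanujan, *Asymptotic formulae in combinatory analysis*, Proc. London Math.
  Soc. (2) 17 (1918) 75–115 (the asymptotic formula; not used).

## Mathlib

`Nat.Partition` with its `Fintype` instance, `Nat.Partition.le_of_mem_parts`,
`Finset.sum_multiset_count_of_subset` (parts and multiplicities), `Finset.prod_univ_sum`,
`Fintype.piFinset` (expanding `∏ ∑`), `geom_sum_Ico_le_of_lt_one`, `mul_neg_geom_sum`,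
`Real.hasSum_pow_div_log_of_abs_lt_one` (`-log(1-y) = ∑ y^m/m`), `hasSum_zeta_two`
(`∑ 1/m² = π²/6`), `hasSum_le`, `Real.add_one_le_exp`. Mathlib has Euler's pentagonal and
Glaisher's theorems for `Nat.Partition` (`Combinatorics/Enumerative/Partition/`) but no growth
estimate for `p(n)` (checked: `lean search 'card.*Nat.Partition|HardyRamanujan'`). Theorems only;
no new definitions.
-/

noncomputable section

open Finset Real
open scoped BigOperators

namespace Literature.Combinatorics.Enumerative

variable {n : ℕ}

/-! ### Parts and multiplicities -/

/-- The parts of a partition of `n` lie in `[1, n]`. [folklore] -/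
theorem mem_Icc_of_mem_parts (p : Nat.Partition n) {m : ℕ} (hm : m ∈ p.parts) : m ∈ Icc 1 n :=
  mem_Icc.2 ⟨p.parts_pos hm, Nat.Partition.le_of_mem_parts hm⟩

/-- `∑_{m=1}^{n} c_m(p) · m = n` for the multiplicities `c_m(p)` of the parts of `p ⊢ n`. [folklore] -/
theorem sum_Icc_count_smul (p : Nat.Partition n) :
    ∑ m ∈ Icc 1 n, p.parts.count m • m = n := by
  classical
  rw [← Finset.sum_multiset_count_of_subset p.parts (Icc 1 n) fun m hm =>
    mem_Icc_of_mem_parts p (Multiset.mem_toFinset.mp hm)]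
  exact p.parts_sum

/-- A partition of `n` is determined by the multiplicities of the parts `1, …, n`. [folklore] -/
theorem count_parts_injective (n : ℕ) :
    Function.Injective fun (p : Nat.Partition n) (i : Icc 1 n) => p.parts.count (i : ℕ) := by
  intro p q h
  refine Nat.Partition.ext (Multiset.ext.mpr fun m => ?_)
  by_cases hm : m ∈ Icc 1 n
  · exact congr_fun h ⟨m, hm⟩
  · rw [Multiset.count_eq_zero.mpr fun h' => hm (mem_Icc_of_mem_parts p h'),
      Multiset.count_eq_zero.mpr fun h' => hm (mem_Icc_of_mem_parts q h')]

/-- Multiplicities of parts of `p ⊢ n` are at most `n` (indeed at most the number of parts).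
[folklore] -/
theorem count_parts_le (p : Nat.Partition n) (m : ℕ) : p.parts.count m ≤ n := by
  refine (Multiset.count_le_card m p.parts).trans ?_
  have h : Multiset.card p.parts • 1 ≤ p.parts.sum :=
    Multiset.card_nsmul_le_sum fun x hx => (p.parts_pos hx : 1 ≤ x)
  rwa [smul_eq_mul, mul_one, p.parts_sum] at h

/-- `xⁿ = ∏_{k=1}^{n} (x^k)^{c_k(p)}` for every partition `p ⊢ n` with multiplicities `c_k(p)`
(the monomial of `p` in the expansion of `∏_k (1 - x^k)⁻¹`). [cite: Apostol1976, §14.7 Thm. 14.5 (proof)] -/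
theorem prod_pow_pow_count_eq (x : ℝ) (p : Nat.Partition n) :
    ∏ i : Icc 1 n, (x ^ (i : ℕ)) ^ p.parts.count (i : ℕ) = x ^ n := by
  simp_rw [← pow_mul]
  rw [Finset.prod_pow_eq_pow_sum, Finset.sum_coe_sort (Icc 1 n) fun i => i * p.parts.count i]
  congr 1
  conv_rhs => rw [← sum_Icc_count_smul p]
  exact Finset.sum_congr rfl fun m _ => by rw [smul_eq_mul, mul_comm]

/-! ### The generating-function inequality -/

/-- A truncated geometric series is below `(1 - y)⁻¹`: `∑_{c=0}^{N} y^c ≤ (1 - y)⁻¹` for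
`0 ≤ y < 1`. [folklore] -/
theorem sum_range_pow_le_inv_one_sub {y : ℝ} (hy0 : 0 ≤ y) (hy1 : y < 1) (N : ℕ) :
    ∑ c ∈ range N, y ^ c ≤ (1 - y)⁻¹ := by
  have h := geom_sum_Ico_le_of_lt_one (m := 0) (n := N) hy0 hy1
  rwa [pow_zero, one_div, ← Finset.range_eq_Ico] at h

/-- **`p(n) xⁿ ≤ ∏_{k=1}^{n} (1 - x^k)⁻¹`** for `0 ≤ x < 1` (Apostol, proof of Thm. 14.5:
"`p(n) xⁿ < F(x) = ∏ (1 - xⁿ)⁻¹`", here with the finite product over `k ≤ n`, which already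
contains every partition of `n`). Proof: inject the partitions into the multiplicity vectors
`c : [1, n] → {0, …, n}` and expand `∏_k ∑_c (x^k)^c`. [cite: Apostol1976, §14.7 Thm. 14.5 (9)] -/
theorem card_partition_mul_pow_le_prod {x : ℝ} (hx0 : 0 ≤ x) (hx1 : x < 1) (n : ℕ) :
    (Fintype.card (Nat.Partition n) : ℝ) * x ^ n ≤ ∏ k ∈ Icc 1 n, (1 - x ^ k)⁻¹ := by
  classical
  -- the multiplicity vector of a partition
  set mult : Nat.Partition n → (Icc 1 n → ℕ) := fun p i => p.parts.count (i : ℕ) with hmult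
  have hinj : Function.Injective mult := count_parts_injective n
  -- the weight of a multiplicity vector
  set w : (Icc 1 n → ℕ) → ℝ := fun c => ∏ i : Icc 1 n, (x ^ (i : ℕ)) ^ c i with hw
  have hw_nonneg : ∀ c, 0 ≤ w c := fun c =>
    Finset.prod_nonneg fun i _ => pow_nonneg (pow_nonneg hx0 _) _
  have hwp : ∀ p : Nat.Partition n, w (mult p) = x ^ n := fun p => prod_pow_pow_count_eq x p
  -- the multiplicity vectors lie in the box `{0, …, n}^[1,n]`
  set box : Finset (Icc 1 n → ℕ) := Fintype.piFinset fun _ => range (n + 1) with hbox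
  have himage : (univ : Finset (Nat.Partition n)).image mult ⊆ box := by
    intro c hc
    obtain ⟨p, -, rfl⟩ := mem_image.mp hc
    exact Fintype.mem_piFinset.mpr fun i => mem_range.mpr (Nat.lt_succ_of_le (count_parts_le p i))
  calc (Fintype.card (Nat.Partition n) : ℝ) * x ^ n
      = ∑ p : Nat.Partition n, w (mult p) := by
        simp_rw [hwp, Finset.sum_const, Finset.card_univ, nsmul_eq_mul]
    _ = ∑ c ∈ (univ : Finset (Nat.Partition n)).image mult, w c :=
        (Finset.sum_image fun p _ q _ h => hinj h).symm
    _ ≤ ∑ c ∈ box, w c :=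
        Finset.sum_le_sum_of_subset_of_nonneg himage fun c _ _ => hw_nonneg c
    _ = ∏ i : Icc 1 n, ∑ c ∈ range (n + 1), (x ^ (i : ℕ)) ^ c := by
        rw [hbox, Finset.prod_univ_sum]
    _ ≤ ∏ i : Icc 1 n, (1 - x ^ (i : ℕ))⁻¹ := by
        refine Finset.prod_le_prod (fun i _ => Finset.sum_nonneg fun c _ =>
          pow_nonneg (pow_nonneg hx0 _) _) fun i _ => ?_
        have hi : 1 ≤ (i : ℕ) := (mem_Icc.mp i.2).1
        exact sum_range_pow_le_inv_one_sub (pow_nonneg hx0 _)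
          ((pow_le_of_le_one hx0 hx1.le (by omega)).trans_lt hx1) (n + 1)
    _ = ∏ k ∈ Icc 1 n, (1 - x ^ k)⁻¹ := Finset.prod_coe_sort (Icc 1 n) fun k => (1 - x ^ k)⁻¹

/-! ### The estimate `log F(x) ≤ (π²/6) · x/(1-x)` -/

/-- `m yᵐ⁻¹ (1 - y)`-type inequality (Apostol: "`m x^{m-1} < (1 - x^m)/(1 - x)`"):
`(m+1) x^{m+1} (1 - x) ≤ x (1 - x^{m+1})` for `0 ≤ x ≤ 1`. [cite: Apostol1976, §14.7 Thm. 14.5 (proof)] -/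
theorem succ_mul_pow_succ_mul_one_sub_le {x : ℝ} (hx0 : 0 ≤ x) (hx1 : x ≤ 1) (m : ℕ) :
    (m + 1 : ℝ) * x ^ (m + 1) * (1 - x) ≤ x * (1 - x ^ (m + 1)) := by
  -- `(m+1) x^m ≤ ∑_{j ≤ m} x^j` since each `x^j ≥ x^m`
  have hsum : (m + 1 : ℝ) * x ^ m ≤ ∑ j ∈ range (m + 1), x ^ j := by
    have h : ∑ _j ∈ range (m + 1), x ^ m ≤ ∑ j ∈ range (m + 1), x ^ j :=
      Finset.sum_le_sum fun j hj => pow_le_pow_of_le_one hx0 hx1 (Nat.lt_succ_iff.mp (mem_range.mp hj))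
    rwa [Finset.sum_const, Finset.card_range, nsmul_eq_mul, Nat.cast_add, Nat.cast_one] at h
  have h1x : 0 ≤ 1 - x := sub_nonneg.mpr hx1
  calc (m + 1 : ℝ) * x ^ (m + 1) * (1 - x)
      = x * ((1 - x) * ((m + 1 : ℝ) * x ^ m)) := by rw [pow_succ]; ring
    _ ≤ x * ((1 - x) * ∑ j ∈ range (m + 1), x ^ j) :=
        mul_le_mul_of_nonneg_left (mul_le_mul_of_nonneg_left hsum h1x) hx0
    _ = x * (1 - x ^ (m + 1)) := by rw [mul_neg_geom_sum]

/-- The `m`-th term: `∑_{k=1}^{n} (x^k)^{m+1}/(m+1) ≤ x/(1-x) · 1/(m+1)²` for `0 < x < 1`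
(Apostol: `(1/m) ∑_k (x^m)^k = (1/m) x^m/(1 - x^m) ≤ (1/m²) · x/(1 - x)`). [cite: Apostol1976, §14.7 Thm. 14.5 (proof)] -/
theorem sum_pow_pow_div_le {x : ℝ} (hx0 : 0 < x) (hx1 : x < 1) (n m : ℕ) :
    ∑ k ∈ Icc 1 n, (x ^ k) ^ (m + 1) / (m + 1) ≤ x / (1 - x) * (1 / ((m : ℝ) + 1) ^ 2) := by
  set y : ℝ := x ^ (m + 1) with hy
  have hy0 : 0 ≤ y := pow_nonneg hx0.le _
  have hy1 : y < 1 := pow_lt_one₀ hx0.le hx1 (Nat.succ_ne_zero m)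
  have hm : (0 : ℝ) < m + 1 := by positivity
  have h1x : 0 < 1 - x := sub_pos.mpr hx1
  -- `∑_{k=1}^{n} y^k ≤ y/(1-y)`
  have hIcc : Icc 1 n = Ico 1 (n + 1) := by
    ext k
    simp only [mem_Icc, mem_Ico, Nat.lt_succ_iff]
  have hgeom : ∑ k ∈ Icc 1 n, y ^ k ≤ y / (1 - y) := by
    have h := geom_sum_Ico_le_of_lt_one (m := 1) (n := n + 1) hy0 hy1
    rwa [pow_one, ← hIcc] at h
  -- `y/(1-y) ≤ x/((m+1)(1-x))`
  have hfrac : y / (1 - y) ≤ x / ((m + 1) * (1 - x)) := by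
    rw [div_le_div_iff₀ (sub_pos.mpr hy1) (mul_pos hm h1x)]
    have h := succ_mul_pow_succ_mul_one_sub_le hx0.le hx1.le m
    calc y * ((m + 1 : ℝ) * (1 - x)) = (m + 1 : ℝ) * x ^ (m + 1) * (1 - x) := by rw [hy]; ring
      _ ≤ x * (1 - x ^ (m + 1)) := h
      _ = x * (1 - y) := by rw [hy]
  calc ∑ k ∈ Icc 1 n, (x ^ k) ^ (m + 1) / (m + 1)
      = (∑ k ∈ Icc 1 n, y ^ k) / (m + 1) := by
        rw [Finset.sum_div]
        refine Finset.sum_congr rfl fun k _ => ?_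
        rw [hy, ← pow_mul, ← pow_mul, mul_comm]
    _ ≤ (y / (1 - y)) / (m + 1) := div_le_div_of_nonneg_right hgeom hm.le
    _ ≤ (x / ((m + 1) * (1 - x))) / (m + 1) := div_le_div_of_nonneg_right hfrac hm.le
    _ = x / (1 - x) * (1 / ((m : ℝ) + 1) ^ 2) := by
        field_simp

/-- **`log F_n(x) ≤ (π²/6) · x/(1-x)`**: `∑_{k=1}^{n} -log(1 - x^k) ≤ (π²/6) · x/(1 - x)` for
`0 < x < 1` (Apostol (10), with `t = (1-x)/x`: `log F(x) < π²/(6t)`), by expanding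
`-log(1 - x^k) = ∑_m x^{km}/m`, exchanging the sums and `∑ 1/m² = π²/6`. [cite: Apostol1976, §14.7 Thm. 14.5 (10)] -/
theorem sum_neg_log_one_sub_pow_le {x : ℝ} (hx0 : 0 < x) (hx1 : x < 1) (n : ℕ) :
    ∑ k ∈ Icc 1 n, -Real.log (1 - x ^ k) ≤ π ^ 2 / 6 * (x / (1 - x)) := by
  -- each `-log(1 - x^k)` as a power series
  have hk : ∀ k ∈ Icc 1 n,
      HasSum (fun m : ℕ => (x ^ k) ^ (m + 1) / (m + 1)) (-Real.log (1 - x ^ k)) := fun k hk => by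
    refine Real.hasSum_pow_div_log_of_abs_lt_one ?_
    rw [abs_of_nonneg (pow_nonneg hx0.le _)]
    exact pow_lt_one₀ hx0.le hx1 (by have := (mem_Icc.mp hk).1; omega)
  have hS : HasSum (fun m : ℕ => ∑ k ∈ Icc 1 n, (x ^ k) ^ (m + 1) / (m + 1))
      (∑ k ∈ Icc 1 n, -Real.log (1 - x ^ k)) := hasSum_sum hk
  -- `∑_{m ≥ 0} 1/(m+1)² = π²/6`
  have hzeta : HasSum (fun m : ℕ => 1 / ((m : ℝ) + 1) ^ 2) (π ^ 2 / 6) := by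
    have h := (hasSum_nat_add_iff' 1).mpr hasSum_zeta_two
    simp only [Finset.sum_range_one, Nat.cast_zero, ne_eq, OfNat.ofNat_ne_zero, not_false_eq_true,
      zero_pow, div_zero, sub_zero, Nat.cast_add, Nat.cast_one] at h
    exact h
  have hT : HasSum (fun m : ℕ => x / (1 - x) * (1 / ((m : ℝ) + 1) ^ 2))
      (x / (1 - x) * (π ^ 2 / 6)) := hzeta.mul_left _
  rw [mul_comm]
  exact hasSum_le (fun m => sum_pow_pow_div_le hx0 hx1 n m) hS hT

/-- **`∏_{k=1}^{n} (1 - x^k)⁻¹ ≤ exp((π²/6) · x/(1-x))`** for `0 < x < 1`. [cite: Apostol1976, §14.7 Thm. 14.5 (10)] -/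
theorem prod_inv_one_sub_pow_le_exp {x : ℝ} (hx0 : 0 < x) (hx1 : x < 1) (n : ℕ) :
    ∏ k ∈ Icc 1 n, (1 - x ^ k)⁻¹ ≤ Real.exp (π ^ 2 / 6 * (x / (1 - x))) := by
  have hprod : ∏ k ∈ Icc 1 n, (1 - x ^ k)⁻¹ = Real.exp (∑ k ∈ Icc 1 n, -Real.log (1 - x ^ k)) := by
    rw [Real.exp_sum]
    refine Finset.prod_congr rfl fun k hk => ?_
    have h : 0 < 1 - x ^ k :=
      sub_pos.mpr (pow_lt_one₀ hx0.le hx1 (by have := (mem_Icc.mp hk).1; omega))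
    rw [Real.exp_neg, Real.exp_log h]
  rw [hprod]
  exact Real.exp_le_exp.mpr (sum_neg_log_one_sub_pow_le hx0 hx1 n)

/-! ### The bound for `p(n)` -/

/-- **`p(n) ≤ exp(n t + π²/(6t))` for every `t > 0`** (Apostol (10):
`log p(n) < log F(x) + n log(1/x) < π²/(6t) + n t`, `t = (1 - x)/x`, using `log(1 + t) < t`).
[cite: Apostol1976, §14.7 Thm. 14.5 (10)] -/
theorem card_partition_le_exp_add {t : ℝ} (ht : 0 < t) (n : ℕ) :
    (Fintype.card (Nat.Partition n) : ℝ) ≤ Real.exp (n * t + π ^ 2 / (6 * t)) := by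
  -- `x = 1/(1+t)`, so that `x/(1-x) = 1/t` and `x⁻¹ = 1 + t ≤ eᵗ`
  set x : ℝ := (1 + t)⁻¹ with hx
  have h1t : 0 < 1 + t := by positivity
  have hx0 : 0 < x := inv_pos.mpr h1t
  have hx1 : x < 1 := inv_lt_one_of_one_lt₀ (by linarith)
  have hxt : x / (1 - x) = 1 / t := by
    have h1 : 1 - x = x * t := by
      rw [hx]
      calc (1 : ℝ) - (1 + t)⁻¹ = (1 + t) * (1 + t)⁻¹ - (1 + t)⁻¹ := by rw [mul_inv_cancel₀ h1t.ne']
        _ = (1 + t)⁻¹ * t := by ring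
    rw [h1, ← div_div, div_self hx0.ne']
  have hxn : 0 < x ^ n := pow_pos hx0 n
  have h1 := card_partition_mul_pow_le_prod hx0.le hx1 n
  have h2 := prod_inv_one_sub_pow_le_exp hx0 hx1 n
  rw [hxt] at h2
  -- `(xⁿ)⁻¹ = (1+t)ⁿ ≤ exp(n t)`
  have hinv : (x ^ n)⁻¹ ≤ Real.exp (n * t) := by
    rw [hx, inv_pow, inv_inv, Real.exp_nat_mul]
    exact pow_le_pow_left₀ h1t.le (by linarith [Real.add_one_le_exp t]) n
  calc (Fintype.card (Nat.Partition n) : ℝ)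
      = (Fintype.card (Nat.Partition n) : ℝ) * x ^ n * (x ^ n)⁻¹ := by
        rw [mul_inv_cancel_right₀ hxn.ne']
    _ ≤ (∏ k ∈ Icc 1 n, (1 - x ^ k)⁻¹) * (x ^ n)⁻¹ :=
        mul_le_mul_of_nonneg_right h1 (inv_nonneg.mpr hxn.le)
    _ ≤ Real.exp (π ^ 2 / 6 * (1 / t)) * Real.exp (n * t) :=
        mul_le_mul h2 hinv (inv_nonneg.mpr hxn.le) (Real.exp_pos _).le
    _ = Real.exp (n * t + π ^ 2 / (6 * t)) := by
        rw [← Real.exp_add, div_mul_div_comm, mul_one, add_comm]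

/-- **Apostol, Theorem 14.5: `p(n) ≤ e^{π√(2n/3)}`** for every `n` (the choice `t = π/√(6n)`
equalises `n t = π²/(6t) = π√n/√6`). [cite: Apostol1976, §14.7 Thm. 14.5] -/
theorem card_partition_le_exp (n : ℕ) :
    (Fintype.card (Nat.Partition n) : ℝ) ≤ Real.exp (π * Real.sqrt (2 * n / 3)) := by
  rcases Nat.eq_zero_or_pos n with rfl | hn
  · simp
  have hn' : (0 : ℝ) < n := by exact_mod_cast hn
  -- `s = √(6n)`, `t = π/s`
  set s : ℝ := Real.sqrt (6 * n) with hs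
  have hs0 : 0 < s := Real.sqrt_pos.mpr (by positivity)
  have hss : s * s = 6 * n := Real.mul_self_sqrt (by positivity)
  have ht : 0 < π / s := div_pos Real.pi_pos hs0
  refine (card_partition_le_exp_add ht n).trans (Real.exp_le_exp.mpr (le_of_eq ?_))
  -- `n (π/s) + π²/(6 π/s) = π s/6 + π s/6 = π s/3 = π √(2n/3)`
  have hsq : Real.sqrt (2 * n / 3) = s / 3 := by
    rw [hs, eq_div_iff (by norm_num : (3 : ℝ) ≠ 0)]
    rw [show (6 : ℝ) * n = 3 ^ 2 * (2 * n / 3) by ring, Real.sqrt_mul (by positivity),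
      Real.sqrt_sq (by norm_num : (0 : ℝ) ≤ 3)]
    ring
  rw [hsq]
  have hn6 : (n : ℝ) = s * s / 6 := by rw [hss]; ring
  rw [hn6]
  field_simp
  ring

/-- The same bound written with the Vershik–Kerov constant `c₁ = π/√6`:
**`p(n) ≤ e^{2 (π/√6) √n}`** (`2π/√6 = π√(2/3)`). [cite: Apostol1976, §14.7 Thm. 14.5] -/
theorem card_partition_le_exp' (n : ℕ) :
    (Fintype.card (Nat.Partition n) : ℝ) ≤ Real.exp (2 * (π / Real.sqrt 6) * Real.sqrt n) := by
  refine (card_partition_le_exp n).trans (Real.exp_le_exp.mpr (le_of_eq ?_))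
  have h6 : 0 < Real.sqrt 6 := Real.sqrt_pos.mpr (by norm_num)
  have h66 : Real.sqrt 6 * Real.sqrt 6 = 6 := Real.mul_self_sqrt (by norm_num)
  have hsq : Real.sqrt (2 * n / 3) = 2 * Real.sqrt n / Real.sqrt 6 := by
    rw [eq_div_iff h6.ne', ← Real.sqrt_mul (by positivity : (0 : ℝ) ≤ 2 * n / 3)]
    rw [show (2 : ℝ) * n / 3 * 6 = 2 ^ 2 * n by ring, Real.sqrt_mul (by positivity),
      Real.sqrt_sq (by norm_num : (0 : ℝ) ≤ 2)]
  rw [hsq]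
  field_simp

end Literature.Combinatorics.Enumerative

end
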